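import Summits.ValiantsHypothesis.ValiantsHypothesis.Theorems.BarrierLeverAnchoredDoorHitsLowerPairsLefMove
import Summits.ValiantsHypothesis.ValiantsHypothesis.Theorems.BarrierLeverAnchoredDoorHitsLowerPairsGraphPairs

/-!
# Support item `AnchoredDoorHitsLowerPairs` (stmt-ValiantsHypothesis-22510), line `anchored-peeling`:
# STUB OFFER `stub_lefStep` — the LEF conjecture as a named statement, and its kernel-checked composition into the line

Prover file (cell valiant-natproofs, rung V4, 𝒟-side; seat val-np-p2 gen 11; `--supports stmt-ValiantsHypothesis-22510`). One `def` (the statement)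
and its compositions; offered to the planner (valiant-natproofs-p1 g19/g20) as an ALTERNATIVE open stub of the line, in the same way
`Stmt.stub_vertexStep` was offered by val-np-p2 g10 (`…VertexStep.lean`, p585609).

THE STATEMENT (`Stmt.stub_lefStep`, profile 1). For every injective simplicial pair `(u, w)` and every vertex `a` of the rows there is a partner
map `π : Fin h → Fin h` whose LEF layout matrix (`ThinStep.lefEntry a π 1`, file `…LefMove`, p594607: deletion rows = the symbolic entries,
link rows = `Σ_c Σ_{Z ⊆ π⁻¹ c ∖ a, Z ⊆ S₁} [x^{S₁∖Z} y^{W∖c}] 𝔄₁`, i.e. `ℓ·ρ′_{S₁} + Σ_{b∈S₁} y_{π b} ρ′_{S₁∖b}` for injective `π`) is nonsingular.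
EVIDENCE (seat memo HOME/val-np-p2/g11/TU1-GAME-valnp2-g11.md §6; kit j296650–j296659 LEF census): with ≤ 8 random injective `π` per vertex,
EVERY vertex of EVERY random lower pair tested at supports (4,4)…(5,6) (850 pairs locally; kit sizes (5,5)–(7,7)) has a nonsingular LEF matrix,
including all known thick cores ((K_5, 2^[4]), cube-vs-ball, P_4, dense cores) where the star / thin moves of the line have no move.

COMPOSITIONS (kernel-checked, definition-free apart from the statement): `symbolicDet_one_ne_zero_of_lefStep` — the stub gives profile-1 symbolic
non-vanishing on EVERY injective simplicial pair, every `h` (no induction needed: a pair with `r ≥ 2` has a vertex, and `symbolicDet_ne_zero_of_lef`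
applies; `r ≤ 1` is `stub_base`); `stub_symbolicNonvanishing_of_lefStep` (`s = 1`, `h₀ = 0`); `symbolicDet_ne_zero_of_lefStep` (any `s ≥ 1`).
So the skeleton may carry `AnchoredDoorHitsLowerPairs_of_lefStep := stub_genericPoint ∘ stub_symbolicNonvanishing_of_lefStep`.
Relation to `stub_vertexStep`: LEF at `a` proves the vertex step at `a` WITHOUT using its deletion hypothesis (it is a one-member certificate);
conversely nothing is claimed.

WHAT THIS IS NOT: `Stmt.stub_lefStep` is OPEN (numerical evidence only); nothing on crux stmt-ValiantsHypothesis-14610 or `VP` versus `VNP`.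
-/

set_option linter.dupNamespace false

namespace Summit.ValiantsHypothesis.ValiantsHypothesis.Theorems.BarrierLever.AnchoredPeeling

open Finset MvPolynomial

noncomputable section

/-- **LEF STEP (stub statement, profile 1).** At every vertex of the rows of an injective simplicial pair some partner map has a
nonsingular LEF layout matrix. -/
def Stmt.stub_lefStep : Prop :=
  ∀ (h r : ℕ) (u w : Fin r → Finset (Fin h)), Function.Injective u → Function.Injective w →
    IsLowerSet (Set.range u) → IsLowerSet (Set.range w) →
    ∀ (a : Fin h), (∃ i, a ∈ u i) →
      ∃ π : Fin h → Fin h, (Matrix.of fun i j : Fin r => ThinStep.lefEntry a π 1 (u i) (w j)).det ≠ 0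

/-- **The LEF step gives profile-1 symbolic non-vanishing on every injective simplicial pair, every `h`.** -/
theorem symbolicDet_one_ne_zero_of_lefStep (H : Stmt.stub_lefStep) (h r : ℕ) (u w : Fin r → Finset (Fin h))
    (hu : Function.Injective u) (hw : Function.Injective w) (hlu : IsLowerSet (Set.range u))
    (hlw : IsLowerSet (Set.range w)) : symbolicDet 1 h r u w ≠ 0 := by
  by_cases hex : ∃ (i : Fin r) (a : Fin h), a ∈ u i
  · obtain ⟨i, a, hia⟩ := hex
    obtain ⟨π, hπ⟩ := H h r u w hu hw hlu hlw a ⟨i, hia⟩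
    exact ThinStep.symbolicDet_ne_zero_of_lef 1 h r le_rfl u w a π hπ
  · push Not at hex
    exact stub_base 1 h r u w hu hw hlu hlw (ThinStep.le_one_of_no_vertex hu hex)

/-- **The LEF step closes the line's stub `Stmt.stub_symbolicNonvanishing`** (`s = 1`, `h₀ = 0`). -/
theorem stub_symbolicNonvanishing_of_lefStep (H : Stmt.stub_lefStep) : Stmt.stub_symbolicNonvanishing :=
  ⟨1, 0, fun h _ r u w hu hw hlu hlw => symbolicDet_one_ne_zero_of_lefStep H h r u w hu hw hlu hlw⟩

/-- The same at any profile `s ≥ 1`. -/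
theorem symbolicDet_ne_zero_of_lefStep (H : Stmt.stub_lefStep) {s : ℕ} (hs : 1 ≤ s) (h r : ℕ)
    (u w : Fin r → Finset (Fin h)) (hu : Function.Injective u) (hw : Function.Injective w)
    (hlu : IsLowerSet (Set.range u)) (hlw : IsLowerSet (Set.range w)) : symbolicDet s h r u w ≠ 0 :=
  symbolicDet_ne_zero_mono hs (symbolicDet_one_ne_zero_of_lefStep H h r u w hu hw hlu hlw)

/-- Hence every injective simplicial pair is an `AnchoredHit` of 𝔄_s under the LEF step (`s ≥ 1`). -/
theorem anchoredHit_of_lefStep (H : Stmt.stub_lefStep) {s : ℕ} (hs : 1 ≤ s) (h r : ℕ) (u w : Fin r → Finset (Fin h))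
    (hu : Function.Injective u) (hw : Function.Injective w) (hlu : IsLowerSet (Set.range u))
    (hlw : IsLowerSet (Set.range w)) : AnchoredHit s h r u w :=
  stub_genericPoint s h r u w (symbolicDet_ne_zero_of_lefStep H hs h r u w hu hw hlu hlw)

end

end Summit.ValiantsHypothesis.ValiantsHypothesis.Theorems.BarrierLever.AnchoredPeeling
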